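import Summits.CriticalPhenomena.SAWScalingLimit.Theorems.SAWRestrictionRigidityLimitExistsTightUnique
import Summits.CriticalPhenomena.SAWScalingLimit.Theorems.SAWRestrictionRigidityLimitExistsNecessity
import Summits.CriticalPhenomena.SAWScalingLimit.Theorems.SAWRestrictionRigidityLimitExistsCauchy
import Summits.CriticalPhenomena.SAWScalingLimit.Theorems.SAWRestrictionRigidityLimitExistsGeometric
import Summits.CriticalPhenomena.SAWScalingLimit.Theorems.SAWRestrictionRigidityLimitExistsCountable
import Summits.CriticalPhenomena.SAWScalingLimit.Theses.SAWRenewalTightness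
import HarnessLib

/-!
# Strategy census sketch — crux `LimitExists` (stmt-CriticalPhenomena-1371), strategist s2

Typed companions of `STRATEGY-CENSUS.md` (strategist seat `cstrat-stmt-CriticalPhenomena-1371-s2`).
Nothing here is a new line: the file records, as kernel-checked terms over LANDED theorems, why the
candidate decomposition and the candidate alternative lines give no leverage beyond the registered
skeleton `Lines/birth.lean` (`LimitExists_of : (T) → (S) → (C) → LimitExists`).

* `UniqueSubseqLimits` (U) — the uniqueness-of-subsequential-limits clause of
  `limitExists_iff_eventualTight_and_uniqueSubseqLimits` (p149315), stated as a `def`.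
* `LimitExists_of_subs` / `subs_of_LimitExists` / `uniqueSubseqLimits_iff_limitExists_of_eventualTight` —
  the split `LimitExists ⇐ (T) ∧ (U)` is EXACT, and given (T) the piece (U) is the whole crux again.
* `uniqueSubseqLimits_of_registered_line` — the only plan for (U) visible in the tree is the registered
  line's `(S) ∧ (C)` (through `LimitExists_of_items`, p145872).
* `limitExists_of_identification` — any "identification" stub closes the SUMMIT given (T)
  (`SAWRenewalTightness.closes`, landed) and hence the crux (`limitExists_of_sawScalingLimit`, p145874):
  an identification-fed alternative line is a costume (stub ≥ summit given the necessary stub (T)).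
* `eventualTight_necessary` — (T) is necessary (p148374): no line for this crux dodges the stuck goal of
  the (T) chain (stmt-CriticalPhenomena-1372).
-/

noncomputable section

open MeasureTheory Filter Topology Set
open Literature.Probability.RandomPlanarGeometry Literature.Probability.RandomPlanarGeometry.SAW
open Literature.Probability.LatticeModels
open scoped BoundedContinuousFunction Topology

namespace Summit.CriticalPhenomena.SAWScalingLimit.Cruxes.LimitExists.StrategyCensus

open Summit.CriticalPhenomena.SAWScalingLimit.Theses.SAWRestrictionRigidity
  (LimitExists EventualTight AvoidanceCocycleLimit)
open Summit.CriticalPhenomena.SAWScalingLimit.Theses.SAWLoopFugacityFlow (SimpleSubseqLimits)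
open Summit.CriticalPhenomena.SAWScalingLimit.Theorems.SAWRestrictionRigidityLimitExists

/-- **(U) — uniqueness of probability subsequential limits**, verbatim the second clause of
`limitExists_iff_eventualTight_and_uniqueSubseqLimits` (p149315): in every Dobrushin domain, any two
probability measures arising as weak limits of the pushed critical SAW laws along ANY two endpoint
approximations and ANY two mesh sequences `s, s' → 0⁺` coincide.  Candidate sub-crux of the
decomposition `LimitExists ⇐ EventualTight ∧ UniqueSubseqLimits` examined in STRATEGY-CENSUS.md
§Decomposition. -/
def UniqueSubseqLimits : Prop :=
  ∀ (D : DobrushinDomain) (a b a' b' : ℝ → Site 2), SAW.IsEndpointApprox D a b →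
    SAW.IsEndpointApprox D a' b' → ∀ (s s' : ℕ → ℝ) (ν ν' : Measure (CurveClass ℂ)),
    Tendsto s atTop (𝓝[>] (0 : ℝ)) → Tendsto s' atTop (𝓝[>] (0 : ℝ)) →
    IsProbabilityMeasure ν → IsProbabilityMeasure ν' →
    (∀ f : CurveClass ℂ →ᵇ ℝ, Tendsto (fun n => ∫ γ, f γ.curve
      ∂(SAW.law D.carrier (s n) (a (s n)) (b (s n)))) atTop (𝓝 (∫ x, f x ∂ν))) →
    (∀ f : CurveClass ℂ →ᵇ ℝ, Tendsto (fun n => ∫ γ, f γ.curve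
      ∂(SAW.law D.carrier (s' n) (a' (s' n)) (b' (s' n)))) atTop (𝓝 (∫ x, f x ∂ν'))) → ν = ν'

/-- The candidate typed split `(T) → (U) → LimitExists` — its glue is the landed iff (p149315). -/
theorem LimitExists_of_subs : EventualTight → UniqueSubseqLimits → LimitExists :=
  fun hT hU => limitExists_iff_eventualTight_and_uniqueSubseqLimits.mpr ⟨hT, hU⟩

/-- Converse: the split is exact — both pieces are consequences of the crux. -/
theorem subs_of_LimitExists : LimitExists → EventualTight ∧ UniqueSubseqLimits :=
  limitExists_iff_eventualTight_and_uniqueSubseqLimits.mp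

/-- Given the (necessary, staffed) piece (T), the piece (U) IS the crux: filing (U) as a sub-crux
re-files `LimitExists` minus stmt-1372 under a new name. -/
theorem uniqueSubseqLimits_iff_limitExists_of_eventualTight (hT : EventualTight) :
    UniqueSubseqLimits ↔ LimitExists :=
  ⟨LimitExists_of_subs hT, fun h => (subs_of_LimitExists h).2⟩

/-- The one plan for (U) present in the tree: the registered line's stubs (S) and (C) (with (T) for the
existence of subsequential limits), through `LimitExists_of_items` (p145872). -/
theorem uniqueSubseqLimits_of_registered_line (hT : EventualTight) (hS : SimpleSubseqLimits)
    (hC : AvoidanceCocycleLimit) : UniqueSubseqLimits :=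
  (subs_of_LimitExists (LimitExists_of_items hT hS hC)).2

/-- **Costume check for identification-fed lines.**  With (T) in hand, the shared identification crux
`SubseqIdentification` (14 routes; here route `SAWRenewalTightness`, whose deciding theorem
`closes : EventualTight → SubseqIdentification → SAWScalingLimit` is landed) gives the SUMMIT, hence the
crux by `limitExists_of_sawScalingLimit` (p145874).  So a line `stub_eventualTight, stub_subseqIdentification
⊢ LimitExists` has a stub that is ≥ the summit given the other (necessary) stub — not admissible. -/
theorem limitExists_of_identification
    (hT : EventualTight)
    (hI : Summit.CriticalPhenomena.SAWScalingLimit.Theses.SAWRenewalTightness.SubseqIdentification) :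
    LimitExists :=
  limitExists_of_sawScalingLimit
    (Summit.CriticalPhenomena.SAWScalingLimit.Theses.SAWRenewalTightness.closes hT hI)

/-- (T) is necessary for the crux (p148374): every line for `LimitExists` contains the (T) chain's
content, so no alternative line dodges the stuck goals of stmt-CriticalPhenomena-1372. -/
theorem eventualTight_necessary : LimitExists → EventualTight :=
  eventualTight_of_limitExists

/-- The summit implies the crux (p145874) — recorded for the census' costume tests. -/
example : Literature.Probability.RandomPlanarGeometry.SAW.SAWScalingLimit → LimitExists :=
  limitExists_of_sawScalingLimit

/-- The three further EXACT reformulations examined in §Decomposition are landed iffs, cited by name: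
Cauchy form (p163146), geometric-mesh + mesh-continuity form (p164291), countable-observable form
(p156447).  Each open half is either (T) again or a uniqueness/continuity statement whose only plan is
(S) ∧ (C) or another route's identification-type crux — see STRATEGY-CENSUS.md. -/
example := @limitExists_iff_forall_cauchy_integral
example := @limitExists_iff_geometric_and_meshContinuous
example := @limitExists_iff_eventualTight_and_countable

end Summit.CriticalPhenomena.SAWScalingLimit.Cruxes.LimitExists.StrategyCensus

end
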